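import Mathlib.Geometry.Manifold.MFDeriv.Atlas
import Mathlib.Geometry.Manifold.ContMDiff.Atlas
import Mathlib.Geometry.Manifold.ContMDiff.NormedSpace
import Mathlib.Geometry.Manifold.Instances.Real
import Mathlib.Geometry.Manifold.SmoothApprox
import Mathlib.Analysis.InnerProductSpace.Calculus
import Mathlib.Analysis.InnerProductSpace.PiL2
import Mathlib.LinearAlgebra.Matrix.NonsingularInverse
import Mathlib.LinearAlgebra.Matrix.Determinant.Basic
import HarnessLib

/-!
# The unit normal field of an immersed hypersurface `Mᵏ → ℝᵏ⁺¹`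

Topic `Literature/Topology/Immersions`.  Infrastructure for the Gauss map of hypersurfaces
(needed for the formal datum `HasTransversalRotation` of
`Literature.Topology.Immersions.EliashbergMishachev2009_doubleFolds_of_hasTransversalRotation`,
whose unit normal field is only assumed continuous, and by every degree-of-the-Gauss-map
statement): the **generalized cross product** of `k` vectors of `ℝᵏ⁺¹`, the **local smooth unit
normal field** of a `C^∞` immersion `ι : Mᵏ → ℝᵏ⁺¹` built from it in a chart, and the regularity
statement **a continuous unit normal field along a `C^∞` immersed hypersurface is `C^∞`** (it is
locally `±` the smooth one, the sign being locally constant by continuity).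

* `crossVec A` (`A : Fin k → ℝᵏ⁺¹`): the vector whose pairing with `w` is `det [w | A]`
  (`inner_crossVec`, Laplace expansion along the first column); orthogonal to each `A j`
  (`inner_crossVec_self`), non-zero when `A` is linearly independent (`crossVec_ne_zero`),
  entrywise polynomial hence smooth in parameters (`contDiffOn_crossVec`).
* `exists_contMDiffOn_unitNormal`: every point of `M` has a neighbourhood carrying a `C^∞` unit
  vector field `N` with `⟪N m, dι_m v⟫ = 0`.
* `eq_smul_of_inner_mfderiv_eq_zero`: the normal line is one-dimensional — two normal vectors
  are proportional (dimension count `k + 1 = k + 1`).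
* `contMDiff_of_continuous_unitNormal`: a continuous unit normal field is `C^∞`.
* `exists_contMDiff_unit_approx`: a continuous field of unit vectors on a σ-compact manifold,
  smooth near a closed set `S`, is uniformly approximated by `C^∞` fields of unit vectors equal
  to it on `S` (Mathlib's `Continuous.exists_contMDiff_approx_and_eqOn` + normalisation) — the
  smoothing of Gauss-map homotopies such as the datum `HasTransversalRotation`.

Everything is proved; general `k`; manifolds charted on `EuclideanSpace ℝ (Fin k)` with the model
`𝓡 k` (boundaryless), target `EuclideanSpace ℝ (Fin (k + 1))`.

## References

* M. Spivak, *Calculus on Manifolds* (1965), Ch. 4, p. 84: the cross product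
  `v₁ × ⋯ × vₙ₋₁ ∈ ℝⁿ` defined by `⟨w, v₁ × ⋯ × vₙ₋₁⟩ = det(v₁, …, vₙ₋₁, w)` (here with `w` in
  the first column, which changes it by the sign `(-1)ⁿ⁻¹`).
* J. M. Lee, *Introduction to Smooth Manifolds*, 2nd ed., GTM 218 (2013), Ch. 8 (local frames)
  and Ch. 15 (unit normal fields along hypersurfaces of Riemannian manifolds).
All statements here are standard. [folklore]
-/

open scoped Manifold ContDiff Topology InnerProductSpace Matrix
open Set Function

noncomputable section

namespace Literature.Topology.Immersions

/-- Local notation: `𝔼 n` is the model Euclidean space `EuclideanSpace ℝ (Fin n)`. -/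
local notation "𝔼 " n:arg => EuclideanSpace ℝ (Fin n)

variable {k : ℕ}

/-! ### §1 The generalized cross product in `ℝᵏ⁺¹` -/

/-- The square matrix `[w | A]` whose first column is `w` and whose remaining columns are the
vectors `A 0, …, A (k-1)` of `ℝᵏ⁺¹`. [folklore] -/
def consCol (w : 𝔼 (k + 1)) (A : Fin k → 𝔼 (k + 1)) : Matrix (Fin (k + 1)) (Fin (k + 1)) ℝ :=
  Matrix.of fun i j => Fin.cases (w i) (fun j' => A j' i) j

/-- The `i`-th cofactor of the first column of `[w | A]` (it does not depend on `w`): the signed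
minor of the `(k+1) × k` matrix of `A` with the row `i` deleted. [folklore] -/
def crossMinor (A : Fin k → 𝔼 (k + 1)) (i : Fin (k + 1)) : ℝ :=
  (-1) ^ (i : ℕ) * (Matrix.of fun (r : Fin k) (c : Fin k) => A c (i.succAbove r)).det

/-- **The generalized cross product** of `k` vectors of `ℝᵏ⁺¹`: the vector `crossVec A` with
`⟪crossVec A, w⟫ = det [w | A]` for all `w` (Spivak, *Calculus on Manifolds*, §4). [folklore] -/
def crossVec (A : Fin k → 𝔼 (k + 1)) : 𝔼 (k + 1) :=
  WithLp.toLp 2 fun i => crossMinor A i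

/-- Coordinates of the cross product. [folklore] -/
@[simp] theorem crossVec_apply (A : Fin k → 𝔼 (k + 1)) (i : Fin (k + 1)) :
    crossVec A i = crossMinor A i := rfl

/-- Entries of `[w | A]`: first column. [folklore] -/
@[simp] theorem consCol_apply_zero (w : 𝔼 (k + 1)) (A : Fin k → 𝔼 (k + 1)) (i : Fin (k + 1)) :
    consCol w A i 0 = w i := rfl

/-- Entries of `[w | A]`: later columns. [folklore] -/
@[simp] theorem consCol_apply_succ (w : 𝔼 (k + 1)) (A : Fin k → 𝔼 (k + 1)) (i : Fin (k + 1))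
    (j : Fin k) : consCol w A i j.succ = A j i := rfl

/-- **Defining property of the cross product**: `⟪crossVec A, w⟫ = det [w | A]` (Laplace
expansion along the first column). [folklore] -/
theorem inner_crossVec (A : Fin k → 𝔼 (k + 1)) (w : 𝔼 (k + 1)) :
    ⟪crossVec A, w⟫_ℝ = (consCol w A).det := by
  rw [Matrix.det_succ_column_zero, PiLp.inner_apply]
  refine Finset.sum_congr rfl fun i _ => ?_
  have hsub : (consCol w A).submatrix i.succAbove Fin.succ =
      Matrix.of fun (r : Fin k) (c : Fin k) => A c (i.succAbove r) := by
    ext r c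
    simp [consCol]
  rw [hsub, consCol_apply_zero, crossVec_apply, crossMinor]
  simp only [RCLike.inner_apply, conj_trivial]
  ring

/-- **The cross product is orthogonal to each of the vectors** (`det` with two equal columns).
[folklore] -/
theorem inner_crossVec_self (A : Fin k → 𝔼 (k + 1)) (j : Fin k) : ⟪crossVec A, A j⟫_ℝ = 0 := by
  rw [inner_crossVec]
  exact Matrix.det_zero_of_column_eq (Fin.succ_ne_zero j).symm fun i => by simp

/-- **The cross product of linearly independent vectors is non-zero**: complete `A` by a vector
`w` outside its span; then `det [w | A] ≠ 0`. [folklore] -/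
theorem crossVec_ne_zero {A : Fin k → 𝔼 (k + 1)} (hA : LinearIndependent ℝ A) : crossVec A ≠ 0 := by
  -- a vector outside the span of `A` (the span has dimension `k < k + 1`)
  have hlt : Module.finrank ℝ (Submodule.span ℝ (Set.range A)) < Module.finrank ℝ (𝔼 (k + 1)) := by
    rw [finrank_span_eq_card hA, finrank_euclideanSpace_fin, Fintype.card_fin]
    exact Nat.lt_succ_self k
  obtain ⟨w, -, hw⟩ := SetLike.exists_of_lt (Submodule.lt_top_of_finrank_lt_finrank hlt)
  have hcons : LinearIndependent ℝ (Fin.cons w A : Fin (k + 1) → 𝔼 (k + 1)) :=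
    linearIndependent_finCons.2 ⟨hA, hw⟩
  -- hence the columns of `[w | A]` are independent and its determinant is non-zero
  have hcols : LinearIndependent ℝ (consCol w A).col := by
    have hmap := hcons.map' ((WithLp.linearEquiv 2 ℝ (Fin (k + 1) → ℝ)).toLinearMap)
      (LinearEquiv.ker _)
    have hfun : (consCol w A).col =
        ⇑((WithLp.linearEquiv 2 ℝ (Fin (k + 1) → ℝ)).toLinearMap) ∘ Fin.cons w A := by
      funext j
      refine Fin.cases ?_ (fun j' => ?_) j
      · funext i
        simp [Matrix.col, consCol]
      · funext i
        simp [Matrix.col, consCol]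
    rw [hfun]
    exact hmap
  have hdet : (consCol w A).det ≠ 0 := by
    have hU : IsUnit (consCol w A) := Matrix.linearIndependent_cols_iff_isUnit.1 hcols
    rw [Matrix.isUnit_iff_isUnit_det, isUnit_iff_ne_zero] at hU
    exact hU
  intro h0
  apply hdet
  rw [← inner_crossVec, h0, inner_zero_left]

/-- **Smooth dependence on parameters**: if the vectors `A x c` depend `Cⁿ`-smoothly on `x ∈ U`
(coordinatewise), so does their cross product (its entries are polynomials in the entries).
[folklore] -/
theorem contDiffOn_crossVec {X : Type*} [NormedAddCommGroup X] [NormedSpace ℝ X] {n : WithTop ℕ∞}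
    {A : X → Fin k → 𝔼 (k + 1)} {U : Set X}
    (hA : ∀ (c : Fin k) (i : Fin (k + 1)), ContDiffOn ℝ n (fun x => A x c i) U) :
    ContDiffOn ℝ n (fun x => crossVec (A x)) U := by
  rw [contDiffOn_euclidean]
  intro i
  simp only [crossVec_apply, crossMinor]
  refine contDiffOn_const.mul ?_
  simp_rw [Matrix.det_apply']
  refine ContDiffOn.sum fun σ _ => contDiffOn_const.mul (contDiffOn_prod fun r _ => ?_)
  simp only [Matrix.of_apply]
  exact hA _ _

/-! ### §2 Local smooth unit normal fields of an immersed hypersurface -/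

section Hypersurface

variable {M : Type*} [TopologicalSpace M] [ChartedSpace (𝔼 k) M] [IsManifold (𝓡 k) ∞ M]
  {ι : M → 𝔼 (k + 1)}

/-- A linear map applied to a vector of `ℝᵏ` is the corresponding combination of its values on
the standard basis. [folklore] -/
theorem clm_apply_eq_sum_smul (L : 𝔼 k →L[ℝ] 𝔼 (k + 1)) (u : 𝔼 k) :
    L u = ∑ c : Fin k, u c • L (EuclideanSpace.single c 1) := by
  conv_lhs => rw [← (EuclideanSpace.basisFun (Fin k) ℝ).sum_repr u]
  simp [map_sum, map_smul]

/-- **Local smooth unit normal field.**  Let `ι : Mᵏ → ℝᵏ⁺¹` be `C^∞` with everywhere injective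
differential.  Every point `m₀` has a neighbourhood `U` (the domain of the chart at `m₀`) with a
`C^∞` field `N` of unit vectors normal to `dι(T_m M)` on `U`: in the chart, `N` is the normalised
cross product of the columns of the Jacobian of `ι ∘ φ⁻¹`. [folklore] -/
theorem exists_contMDiffOn_unitNormal (hι : ContMDiff (𝓡 k) (𝓡 (k + 1)) ∞ ι)
    (hinj : ∀ m, Injective (mfderiv (𝓡 k) (𝓡 (k + 1)) ι m)) (m₀ : M) :
    ∃ U ∈ 𝓝 m₀, ∃ N : M → 𝔼 (k + 1), ContMDiffOn (𝓡 k) 𝓘(ℝ, 𝔼 (k + 1)) ∞ N U ∧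
      (∀ m ∈ U, ‖N m‖ = 1) ∧
      ∀ m ∈ U, ∀ v, ⟪N m, (mfderiv (𝓡 k) (𝓡 (k + 1)) ι m v : 𝔼 (k + 1))⟫_ℝ = 0 := by
  set φ := chartAt (𝔼 k) m₀ with hφ
  set f : 𝔼 k → 𝔼 (k + 1) := ι ∘ φ.symm with hf
  -- `f` is smooth on the chart target
  have hfs : ContDiffOn ℝ ∞ f φ.target := by
    have h1 : ContMDiffOn (𝓡 k) (𝓡 (k + 1)) ∞ f φ.target :=
      hι.comp_contMDiffOn (contMDiffOn_chart_symm (I := 𝓡 k) (H := 𝔼 k) (x := m₀))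
    exact contMDiffOn_iff_contDiffOn.1 h1
  -- columns of the Jacobian and their cross product
  set a : 𝔼 k → Fin k → 𝔼 (k + 1) := fun y c => fderiv ℝ f y (EuclideanSpace.single c 1)
    with ha
  set cr : 𝔼 k → 𝔼 (k + 1) := fun y => crossVec (a y) with hcr
  have hcr_smooth : ContDiffOn ℝ ∞ cr φ.target := by
    apply contDiffOn_crossVec
    intro c i
    have h1 : ContDiffOn ℝ ∞ (fun y => fderiv ℝ f y (EuclideanSpace.single c 1)) φ.target :=
      (hfs.fderiv_of_isOpen φ.open_target (by simp)).clm_apply contDiffOn_const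
    exact (EuclideanSpace.proj (i : Fin (k + 1)) : 𝔼 (k + 1) →L[ℝ] ℝ).contDiff.comp_contDiffOn h1
  -- the Jacobian of `f` is injective on the target
  have hφd : φ.MDifferentiable (𝓡 k) (𝓡 k) := mdifferentiable_chart m₀
  have hfinj : ∀ y ∈ φ.target, Injective (fderiv ℝ f y) := by
    intro y hy
    have hy' : y ∈ φ.symm.source := by rwa [φ.symm_source]
    have h1 : mfderiv 𝓘(ℝ, 𝔼 k) 𝓘(ℝ, 𝔼 (k + 1)) f y =
        (mfderiv (𝓡 k) (𝓡 (k + 1)) ι (φ.symm y)).comp (mfderiv (𝓡 k) (𝓡 k) φ.symm y) :=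
      mfderiv_comp y (hι.mdifferentiableAt (by simp)) (hφd.symm.mdifferentiableAt hy')
    rw [← mfderiv_eq_fderiv, h1]
    exact (hinj _).comp (hφd.symm.mfderiv_injective hy')
  have hcr_ne : ∀ y ∈ φ.target, cr y ≠ 0 := by
    intro y hy
    apply crossVec_ne_zero
    have hli := (EuclideanSpace.basisFun (Fin k) ℝ).toBasis.linearIndependent.map'
      ((fderiv ℝ f y : 𝔼 k →L[ℝ] 𝔼 (k + 1)) : 𝔼 k →ₗ[ℝ] 𝔼 (k + 1))
      (LinearMap.ker_eq_bot.2 (hfinj y hy))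
    have hfun : a y = ⇑((fderiv ℝ f y : 𝔼 k →L[ℝ] 𝔼 (k + 1)) : 𝔼 k →ₗ[ℝ] 𝔼 (k + 1)) ∘
        ⇑(EuclideanSpace.basisFun (Fin k) ℝ).toBasis := by
      funext c
      simp [ha]
    rw [hfun]
    exact hli
  -- the unit normal, in the chart and on `M`
  set N : M → 𝔼 (k + 1) := fun m => ‖cr (φ m)‖⁻¹ • cr (φ m) with hN
  refine ⟨φ.source, φ.open_source.mem_nhds (mem_chart_source _ m₀), N, ?_, ?_, ?_⟩
  · -- smoothness
    have hn : ContDiffOn ℝ ∞ (fun y => ‖cr y‖⁻¹ • cr y) φ.target :=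
      ((hcr_smooth.norm ℝ hcr_ne).inv fun y hy => norm_ne_zero_iff.2 (hcr_ne y hy)).smul
        hcr_smooth
    have hn' : ContMDiffOn 𝓘(ℝ, 𝔼 k) 𝓘(ℝ, 𝔼 (k + 1)) ∞ (fun y => ‖cr y‖⁻¹ • cr y) φ.target :=
      hn.contMDiffOn
    exact hn'.comp (contMDiffOn_chart (I := 𝓡 k) (H := 𝔼 k) (x := m₀)) fun m hm =>
      φ.map_source hm
  · -- unit length
    intro m hm
    have h0 : ‖cr (φ m)‖ ≠ 0 := norm_ne_zero_iff.2 (hcr_ne (φ m) (φ.map_source hm))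
    simp only [hN, norm_smul, norm_inv, norm_norm]
    exact inv_mul_cancel₀ h0
  · -- normality: `dι(m) v = df(φ m)(dφ(m) v)` is a combination of the columns
    intro m hm v
    have hm' : φ m ∈ φ.target := φ.map_source hm
    have heq : ι =ᶠ[𝓝 m] f ∘ φ := by
      filter_upwards [φ.open_source.mem_nhds hm] with m' hm'
      simp [hf, φ.left_inv hm']
    have hfd : MDifferentiableAt 𝓘(ℝ, 𝔼 k) 𝓘(ℝ, 𝔼 (k + 1)) f (φ m) :=
      (((hfs.differentiableOn (by simp)).differentiableAt
        (φ.open_target.mem_nhds hm')).mdifferentiableAt)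
    have h1 : mfderiv (𝓡 k) (𝓡 (k + 1)) ι m v =
        mfderiv 𝓘(ℝ, 𝔼 k) 𝓘(ℝ, 𝔼 (k + 1)) f (φ m) (mfderiv (𝓡 k) (𝓡 k) φ m v) := by
      rw [heq.mfderiv_eq, mfderiv_comp m hfd (hφd.mdifferentiableAt hm)]
      rfl
    set u : 𝔼 k := mfderiv (𝓡 k) (𝓡 k) φ m v with hu
    have hv : (mfderiv (𝓡 k) (𝓡 (k + 1)) ι m v : 𝔼 (k + 1)) = fderiv ℝ f (φ m) u := by
      rw [h1, mfderiv_eq_fderiv]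
      rfl
    rw [hv, clm_apply_eq_sum_smul, inner_sum]
    refine Finset.sum_eq_zero fun c _ => ?_
    rw [inner_smul_right, hN]
    simp only [real_inner_smul_left]
    rw [show fderiv ℝ f (φ m) (EuclideanSpace.single c 1) = a (φ m) c from rfl, hcr,
      inner_crossVec_self]
    ring

omit [IsManifold (𝓡 k) ∞ M] in
/-- **The normal line is one-dimensional**: two vectors normal to `dι(T_m M)` (`dι(m)` injective)
are proportional. [folklore] -/
theorem eq_smul_of_inner_mfderiv_eq_zero {m : M} (hinj : Injective (mfderiv (𝓡 k) (𝓡 (k + 1)) ι m))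
    {n₁ n₂ : 𝔼 (k + 1)} (h₁ : ∀ v, ⟪n₁, (mfderiv (𝓡 k) (𝓡 (k + 1)) ι m v : 𝔼 (k + 1))⟫_ℝ = 0)
    (h₂ : ∀ v, ⟪n₂, (mfderiv (𝓡 k) (𝓡 (k + 1)) ι m v : 𝔼 (k + 1))⟫_ℝ = 0) (hn₂ : n₂ ≠ 0) :
    ∃ t : ℝ, n₁ = t • n₂ := by
  -- the differential as an honest linear map `ℝᵏ → ℝᵏ⁺¹`
  let D : 𝔼 k →ₗ[ℝ] 𝔼 (k + 1) :=
    { toFun := fun v => (mfderiv (𝓡 k) (𝓡 (k + 1)) ι m v : 𝔼 (k + 1))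
      map_add' := fun v v' => (mfderiv (𝓡 k) (𝓡 (k + 1)) ι m).map_add v v'
      map_smul' := fun c v => (mfderiv (𝓡 k) (𝓡 (k + 1)) ι m).map_smul c v }
  have hinjD : Injective D := hinj
  set R : Submodule ℝ (𝔼 (k + 1)) := LinearMap.range D with hR
  have hRk : Module.finrank ℝ R = k := by
    rw [hR, LinearMap.finrank_range_of_inj hinjD, finrank_euclideanSpace_fin]
  have hR1 : Module.finrank ℝ Rᗮ = 1 := by
    have h := Submodule.finrank_add_finrank_orthogonal R
    rw [hRk, finrank_euclideanSpace_fin] at h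
    omega
  have hmem : ∀ n : 𝔼 (k + 1), (∀ v, ⟪n, (mfderiv (𝓡 k) (𝓡 (k + 1)) ι m v : 𝔼 (k + 1))⟫_ℝ = 0) →
      n ∈ Rᗮ := by
    intro n hn
    rw [Submodule.mem_orthogonal]
    rintro _ ⟨v, rfl⟩
    exact inner_eq_zero_symm.1 (hn v)
  have hn₂' : (⟨n₂, hmem n₂ h₂⟩ : Rᗮ) ≠ 0 := by
    intro h
    apply hn₂
    simpa using congrArg Subtype.val h
  obtain ⟨t, ht⟩ := (finrank_eq_one_iff_of_nonzero' _ hn₂').1 hR1 ⟨n₁, hmem n₁ h₁⟩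
  refine ⟨t, ?_⟩
  have := congrArg Subtype.val ht
  simpa using this.symm

/-- **A continuous unit normal field along a `C^∞` immersed hypersurface is `C^∞`.**  Near each
point it is `±` the smooth local unit normal of `exists_contMDiffOn_unitNormal`, with a sign
which is continuous and `{±1}`-valued, hence locally constant. [folklore] -/
theorem contMDiff_of_continuous_unitNormal (hι : ContMDiff (𝓡 k) (𝓡 (k + 1)) ∞ ι)
    (hinj : ∀ m, Injective (mfderiv (𝓡 k) (𝓡 (k + 1)) ι m)) {ν : M → 𝔼 (k + 1)}
    (hν : Continuous ν) (hν1 : ∀ m, ‖ν m‖ = 1)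
    (hνn : ∀ m v, ⟪ν m, (mfderiv (𝓡 k) (𝓡 (k + 1)) ι m v : 𝔼 (k + 1))⟫_ℝ = 0) :
    ContMDiff (𝓡 k) 𝓘(ℝ, 𝔼 (k + 1)) ∞ ν := by
  intro m₀
  obtain ⟨U, hU, N, hNs, hN1, hNn⟩ := exists_contMDiffOn_unitNormal hι hinj m₀
  -- on `U`, `ν = t • N` with `t = ⟪ν, N⟫ = ±1`
  have hprop : ∀ m ∈ U, ν m = ⟪ν m, N m⟫_ℝ • N m ∧ (⟪ν m, N m⟫_ℝ = 1 ∨ ⟪ν m, N m⟫_ℝ = -1) := by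
    intro m hm
    have hN0 : N m ≠ 0 := by
      rw [← norm_ne_zero_iff, hN1 m hm]
      exact one_ne_zero
    obtain ⟨t, ht⟩ := eq_smul_of_inner_mfderiv_eq_zero (hinj m) (hνn m) (hNn m hm) hN0
    have hinner : ⟪ν m, N m⟫_ℝ = t := by
      rw [ht, real_inner_smul_left, real_inner_self_eq_norm_sq, hN1 m hm]
      ring
    refine ⟨by rw [hinner]; exact ht, ?_⟩
    have habs : |t| = 1 := by
      have := congrArg norm ht
      rw [norm_smul, hν1, hN1 m hm, mul_one, Real.norm_eq_abs] at this
      exact this.symm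
    rw [hinner]
    rcases abs_eq zero_le_one |>.1 habs with h | h
    · exact Or.inl h
    · exact Or.inr h
  -- an open neighbourhood inside `U` on which the sign is that of `m₀`
  obtain ⟨V, hVU, hVo, hmV⟩ := mem_nhds_iff.1 hU
  set s₀ : ℝ := ⟪ν m₀, N m₀⟫_ℝ with hs₀
  have hs₀sq : s₀ * s₀ = 1 := by
    rcases (hprop m₀ (hVU hmV)).2 with h | h <;> rw [hs₀, h] <;> norm_num
  have hcont : ContinuousOn (fun m => s₀ * ⟪ν m, N m⟫_ℝ) V :=
    continuousOn_const.mul ((hν.continuousOn).inner (hNs.continuousOn.mono hVU))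
  set W : Set M := V ∩ (fun m => s₀ * ⟪ν m, N m⟫_ℝ) ⁻¹' Set.Ioi 0 with hW
  have hWo : IsOpen W := hcont.isOpen_inter_preimage hVo isOpen_Ioi
  have hmW : m₀ ∈ W := by
    refine ⟨hmV, ?_⟩
    show 0 < s₀ * ⟪ν m₀, N m₀⟫_ℝ
    rw [← hs₀, hs₀sq]
    exact one_pos
  have heqW : ∀ m ∈ W, ν m = s₀ • N m := by
    rintro m ⟨hmV', hpos⟩
    obtain ⟨heq, hsign⟩ := hprop m (hVU hmV')
    have ht : ⟪ν m, N m⟫_ℝ = s₀ := by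
      have hpos' : 0 < s₀ * ⟪ν m, N m⟫_ℝ := hpos
      rcases (hprop m₀ (hVU hmV)).2 with h0 | h0 <;> rcases hsign with h | h <;>
        rw [← hs₀] at h0 <;> rw [h0, h] at hpos' <;> norm_num at hpos' <;> rw [h, h0]
    rw [heq, ht]
  -- conclude
  have hev : ν =ᶠ[𝓝 m₀] fun m => s₀ • N m := by
    filter_upwards [hWo.mem_nhds hmW] with m hm using heqW m hm
  have hNat : ContMDiffAt (𝓡 k) 𝓘(ℝ, 𝔼 (k + 1)) ∞ (fun m => s₀ • N m) m₀ :=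
    (contDiff_id.const_smul s₀).comp_contMDiffAt (hNs.contMDiffAt hU)
  exact hNat.congr_of_eventuallyEq hev

end Hypersurface

/-! ### §3 Unit vector fields: relative smooth approximation

A continuous field of unit vectors (e.g. a Gauss map, or a homotopy of such, read on `M × ℝ`)
which is already smooth near a closed set `S` can be uniformly approximated by a `C^∞` field of
UNIT vectors equal to it on `S`: approximate in the ambient inner product space (Mathlib's
`Continuous.exists_contMDiff_approx_and_eqOn`, smooth partitions of unity) and normalise. -/

section UnitApprox

variable {F : Type*} [NormedAddCommGroup F] [InnerProductSpace ℝ F]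
  {E H : Type*} [NormedAddCommGroup E] [NormedSpace ℝ E] [FiniteDimensional ℝ E]
  [TopologicalSpace H] (I : ModelWithCorners ℝ E H)
  {X : Type*} [TopologicalSpace X] [ChartedSpace H X] [IsManifold I ∞ X] [SigmaCompactSpace X]
  [T2Space X]

/-- Normalisation `w ↦ w / ‖w‖` is `C^∞` away from the origin. [folklore] -/
theorem contDiffAt_normalize {w : F} (hw : w ≠ 0) :
    ContDiffAt ℝ ∞ (fun v : F => ‖v‖⁻¹ • v) w :=
  ((contDiffAt_norm ℝ hw).inv (norm_ne_zero_iff.2 hw)).smul contDiffAt_id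

omit [InnerProductSpace ℝ F] in
/-- Distance from a vector to its normalisation: `‖w/‖w‖ - w‖ = |1 - ‖w‖|` (`w ≠ 0`). [folklore] -/
theorem norm_normalize_sub_self [NormedSpace ℝ F] {w : F} (hw : w ≠ 0) :
    ‖‖w‖⁻¹ • w - w‖ = |1 - ‖w‖| := by
  have hn : ‖w‖ ≠ 0 := norm_ne_zero_iff.2 hw
  have h : ‖w‖⁻¹ • w - w = (‖w‖⁻¹ - 1) • w := by rw [sub_smul, one_smul]
  rw [h, norm_smul, Real.norm_eq_abs]
  have h2 : |‖w‖⁻¹ - 1| * ‖w‖ = |(‖w‖⁻¹ - 1) * ‖w‖| := by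
    rw [abs_mul, abs_of_nonneg (norm_nonneg w)]
  rw [h2]
  congr 1
  field_simp

/-- **Relative smooth approximation by unit vector fields.**  Let `f : X → F` be a continuous
field of unit vectors on a σ-compact Hausdorff `C^∞` manifold `X`, `C^∞` on a neighbourhood `U`
of a closed set `S`.  For every `ε > 0` there is a `C^∞` field `g` of unit vectors with `g = f`
on `S` and `‖g - f‖ < ε` everywhere. [folklore] -/
theorem exists_contMDiff_unit_approx {f : X → F} (hf : Continuous f) (hf1 : ∀ x, ‖f x‖ = 1)
    {S U : Set X} (hS : IsClosed S) (hU : U ∈ 𝓝ˢ S) (hfU : ContMDiffOn I 𝓘(ℝ, F) ∞ f U)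
    {ε : ℝ} (hε : 0 < ε) :
    ∃ g : X → F, ContMDiff I 𝓘(ℝ, F) ∞ g ∧ (∀ x, ‖g x‖ = 1) ∧ EqOn g f S ∧
      ∀ x, ‖g x - f x‖ < ε := by
  set ε' : ℝ := min (ε / 2) (1 / 2) with hε'
  have hε'pos : 0 < ε' := lt_min (by linarith) (by norm_num)
  have hε'le : ε' ≤ ε / 2 := min_le_left _ _
  have hε'half : ε' ≤ 1 / 2 := min_le_right _ _
  obtain ⟨g₀, hg₀, hg₀S, -⟩ := hf.exists_contMDiff_approx_and_eqOn I ⊤ continuous_const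
    (fun _ => hε'pos) hS hU hfU
  have hdist : ∀ x, ‖g₀ x - f x‖ < ε' := fun x => by rw [← dist_eq_norm]; exact hg₀ x
  have hnorm : ∀ x, |1 - ‖g₀ x‖| < ε' := fun x => by
    calc |1 - ‖g₀ x‖| = |‖f x‖ - ‖g₀ x‖| := by rw [hf1 x]
      _ ≤ ‖f x - g₀ x‖ := abs_norm_sub_norm_le _ _
      _ = ‖g₀ x - f x‖ := norm_sub_rev _ _
      _ < ε' := hdist x
  have hne : ∀ x, g₀ x ≠ 0 := by
    intro x h0
    have := hnorm x
    rw [h0, norm_zero, sub_zero, abs_one] at this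
    linarith
  refine ⟨fun x => ‖g₀ x‖⁻¹ • g₀ x, ?_, ?_, ?_, ?_⟩
  · intro x
    exact (contDiffAt_normalize (hne x)).comp_contMDiffAt (g₀.contMDiff x)
  · intro x
    rw [norm_smul, norm_inv, norm_norm, inv_mul_cancel₀ (norm_ne_zero_iff.2 (hne x))]
  · intro x hx
    simp only
    rw [hg₀S hx, hf1 x, inv_one, one_smul]
  · intro x
    calc ‖‖g₀ x‖⁻¹ • g₀ x - f x‖
        ≤ ‖‖g₀ x‖⁻¹ • g₀ x - g₀ x‖ + ‖g₀ x - f x‖ := norm_sub_le_norm_sub_add_norm_sub _ _ _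
      _ = |1 - ‖g₀ x‖| + ‖g₀ x - f x‖ := by rw [norm_normalize_sub_self (hne x)]
      _ < ε' + ε' := add_lt_add (hnorm x) (hdist x)
      _ ≤ ε := by linarith

end UnitApprox

end Literature.Topology.Immersions
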